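import Literature.AlgebraicGeometry.Motives.IntegralModelRestrictScalars
import Mathlib.RingTheory.Localization.Away.Basic
import Mathlib.RingTheory.Flat.Localization
import HarnessLib

/-!
# Restriction of scalars of an integral model over an INTERMEDIATE RING `𝓞 L ⊆ B ⊆ L` (e.g. `B = 𝓞 L[1∕N]`) down to `𝓞 F`

Topic `Literature/AlgebraicGeometry/Motives`; namespace `Literature.AlgebraicGeometry.Motives.IntegralModel`.  ED. 2-companion of ★
`Motives/IntegralModelRestrictScalars` (organ «INT-RES», A-p03 (g28)): one plumbing `def` (`restrictScalarsOfIntermediate`) and theorems; no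
named fact, no instance, no notation, no `sorry`.  Cell `hodgecm-mathlib`, P6 «MOD programme», sub-desk P6a, GEN layer — the desk's ED3-CENSUS
(2026-09-01, §6) asks for `𝓜 :=` «integral restriction of scalars of the RSZ model over `𝒪_{E′}[1∕N]`»: the fine moduli scheme lives over a ring
of `N`-INVERTED integers, not over `𝓞 L` itself; this file supplies the pushout square and the EQV-SPREAD binders for that case.  HC_CM is proved
only modulo the printed citations until rung 0 closes; nothing here is about HC.

THE MATHEMATICS.  Let `F ⊆ L` be number fields and `B` a commutative ring with `𝓞 L → B → L` composing to the inclusion and `B → L`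
INJECTIVE (an intermediate ring: `𝓞 L`, `𝓞 L[1∕N]`, any localisation of `𝓞 L` at nonzero elements).  Then `L` is the localisation of `B` at the
nonzero integers OF `F` (`isLocalization_of_injective`: every `z ∈ L` is `b ∕ a` with `b ∈ 𝓞 L ⊆ B`, `a ∈ 𝓞 F ∖ 0`, because `L = Frac 𝓞 L` is
already the localisation of `𝓞 L` at `𝓞 F ∖ 0` — Mathlib `IsIntegralClosure.isLocalization_of_isSeparable`), hence **`L = B ⊗_{𝓞 F} F`**
(`isPushout_of_injective`, Mathlib `Algebra.isPushout_of_isLocalization`) and ★ `IntegralModel.restrictScalars` applies: an integral model `𝓜`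
over `B` of an `L`-scheme `Z` restricts to an integral model over `𝓞 F` of `Z` regarded over `F` (`restrictScalarsOfIntermediate`; for
`Z = X ⊗_F L` the target type is `IntegralModel (𝓞 F) F ((thickening F L).obj X)` on the nose).  The structure map `Spec B → Spec 𝓞 F` is affine,
hence quasi-compact, quasi-separated and separated; it is FLAT when `B` is flat over `𝓞 L` (any localisation is), and LOCALLY OF FINITE
PRESENTATION when `B` is finitely presented over `𝓞 L` (e.g. `B = 𝓞 L[1∕x]`, Mathlib `IsLocalization.Away.finitePresentation`) — so the five
binders of ★ EQV-SPREAD pass from `𝓜.total → Spec B` to the restricted model ([GortzWedhorn2020] Prop. 4.16, §(4.8); [SerreTate1968] §1).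

MAIN STATEMENTS.  `isLocalization_of_injective`, `isPushout_of_injective`, `flat_specMap_of_flat`, `locallyOfFinitePresentation_specMap_of_finitePresentation`,
`flat_of_isLocalization`, `finitePresentation_of_away`, **`restrictScalarsOfIntermediate`** (def), `restrictScalarsOfIntermediate_eq`, `_total_hom`,
`quasiCompact_` ∕ `quasiSeparated_` ∕ `isSeparated_` ∕ `flat_` ∕ `locallyOfFinitePresentation_restrictScalarsOfIntermediate`, and the AWAY instances
`flat_restrictScalarsOfIntermediate_of_away`, `locallyOfFinitePresentation_restrictScalarsOfIntermediate_of_away`,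
`restrictScalarsOfIntermediate_genericIso_hom_left_comp`.

## References
* [GortzWedhorn2020] U. Görtz, T. Wedhorn, *Algebraic Geometry I* (2nd ed.), Prop. 4.16 and §(4.8).
* [Hartshorne1977] R. Hartshorne, *Algebraic Geometry*, II Thm. 3.3 (p. 87).
* [SerreTate1968] J.-P. Serre, J. Tate, *Good reduction of abelian varieties*, Ann. of Math. 88 (1968), §1.
-/

set_option autoImplicit false

noncomputable section

set_option backward.isDefEq.respectTransparency false

open CategoryTheory CategoryTheory.Limits AlgebraicGeometry
open scoped NumberField nonZeroDivisors

namespace Literature.AlgebraicGeometry.Motives.IntegralModel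

section Intermediate

variable {F L : Type} [Field F] [NumberField F] [Field L] [NumberField L] [Algebra F L]
  {B : Type} [CommRing B] [Algebra (𝓞 L) B] [Algebra B L] [IsScalarTower (𝓞 L) B L]
  [Algebra (𝓞 F) B] [IsScalarTower (𝓞 F) B L]

/-- **`L` is the localisation of an intermediate ring `𝓞 L ⊆ B ⊆ L` at the nonzero integers of `F`**: every `z ∈ L` is `b ∕ a` with `b ∈ 𝓞 L`,
`a ∈ 𝓞 F ∖ 0` (Mathlib `IsIntegralClosure.isLocalization_of_isSeparable` for `𝓞 L`, pushed into `B`); `B → L` injective gives the uniqueness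
clause. [cite: Hartshorne1977, II Thm. 3.3 (p. 87)] -/
theorem isLocalization_of_injective (hinj : Function.Injective (algebraMap B L)) :
    IsLocalization (Algebra.algebraMapSubmonoid B (𝓞 F)⁰) L where
  map_units := by
    rintro ⟨_, a, ha, rfl⟩
    refine IsUnit.mk0 _ ?_
    rw [← IsScalarTower.algebraMap_apply, IsScalarTower.algebraMap_apply (𝓞 F) F L]
    exact (map_ne_zero _).mpr fun h => nonZeroDivisors.ne_zero ha
      ((FaithfulSMul.algebraMap_injective (𝓞 F) F) (h.trans (map_zero _).symm))
  surj z := by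
    haveI : IsLocalization (Algebra.algebraMapSubmonoid (𝓞 L) (𝓞 F)⁰) L :=
      IsIntegralClosure.isLocalization_of_isSeparable (𝓞 F) F L (𝓞 L)
    obtain ⟨⟨b, ⟨_, a, ha, rfl⟩⟩, h⟩ := IsLocalization.surj (Algebra.algebraMapSubmonoid (𝓞 L) (𝓞 F)⁰) z
    refine ⟨⟨algebraMap (𝓞 L) B b, ⟨algebraMap (𝓞 F) B a, a, ha, rfl⟩⟩, ?_⟩
    simp only at h ⊢
    rw [← IsScalarTower.algebraMap_apply, ← IsScalarTower.algebraMap_apply]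
    rw [← IsScalarTower.algebraMap_apply] at h
    convert h using 2
  exists_of_eq {x y} h := ⟨1, by simpa using hinj h⟩

/-- **`L = B ⊗_{𝓞 F} F` for an intermediate ring `𝓞 L ⊆ B ⊆ L`** (`B → L` injective): the square `𝓞 F → F`, `B → L` is a pushout
(Mathlib `Algebra.isPushout_of_isLocalization` on `isLocalization_of_injective`). [cite: Hartshorne1977, II Thm. 3.3 (p. 87)] -/
theorem isPushout_of_injective (hinj : Function.Injective (algebraMap B L)) : Algebra.IsPushout (𝓞 F) B F L :=
  haveI := isLocalization_of_injective (F := F) hinj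
  Algebra.isPushout_of_isLocalization (𝓞 F)⁰ F B L

omit [NumberField L] [Algebra B L] [IsScalarTower (𝓞 L) B L] [IsScalarTower (𝓞 F) B L] in
/-- `Spec B → Spec 𝓞 F` is FLAT as soon as `B` is flat over `𝓞 L` (`𝓞 L` is flat over the Dedekind domain `𝓞 F`; Mathlib `Module.Flat.trans`).
[cite: SerreTate1968, §1] -/
theorem flat_specMap_of_flat [IsScalarTower (𝓞 F) (𝓞 L) B] [Module.Flat (𝓞 L) B] : Flat (Spec.map (CommRingCat.ofHom (algebraMap (𝓞 F) B))) := by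
  rw [HasRingHomProperty.Spec_iff (P := @Flat)]
  haveI : Module.Flat (𝓞 F) B := Module.Flat.trans (𝓞 F) (𝓞 L) B
  exact RingHom.flat_algebraMap_iff.mpr inferInstance

omit [Algebra B L] [IsScalarTower (𝓞 L) B L] [IsScalarTower (𝓞 F) B L] in
/-- `Spec B → Spec 𝓞 F` is LOCALLY OF FINITE PRESENTATION as soon as `B` is finitely presented over `𝓞 L` (`𝓞 L` is finite, hence finitely
presented, over the Noetherian ring `𝓞 F`; Mathlib `Algebra.FinitePresentation.trans`). [cite: SerreTate1968, §1] -/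
theorem locallyOfFinitePresentation_specMap_of_finitePresentation [IsScalarTower (𝓞 F) (𝓞 L) B]
    [Algebra.FinitePresentation (𝓞 L) B] :
    LocallyOfFinitePresentation (Spec.map (CommRingCat.ofHom (algebraMap (𝓞 F) B))) := by
  rw [HasRingHomProperty.Spec_iff (P := @LocallyOfFinitePresentation)]
  haveI : Algebra.FinitePresentation (𝓞 F) (𝓞 L) := (Algebra.FinitePresentation.of_finiteType).mp inferInstance
  haveI : Algebra.FinitePresentation (𝓞 F) B := Algebra.FinitePresentation.trans (𝓞 F) (𝓞 L) B
  exact RingHom.finitePresentation_algebraMap.mpr inferInstance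

omit [NumberField L] [Algebra B L] [IsScalarTower (𝓞 L) B L] [Algebra (𝓞 F) B] [IsScalarTower (𝓞 F) B L]
  [NumberField F] [Algebra F L] in
/-- Any localisation `B` of `𝓞 L` is flat over `𝓞 L` (Mathlib `IsLocalization.flat`). [cite: SerreTate1968, §1] -/
theorem flat_of_isLocalization (M : Submonoid (𝓞 L)) [IsLocalization M B] : Module.Flat (𝓞 L) B :=
  IsLocalization.flat B M

omit [NumberField L] [Algebra B L] [IsScalarTower (𝓞 L) B L] [Algebra (𝓞 F) B] [IsScalarTower (𝓞 F) B L]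
  [NumberField F] [Algebra F L] in
/-- `𝓞 L[1∕x]` is finitely presented over `𝓞 L` (Mathlib `IsLocalization.Away.finitePresentation`). [cite: SerreTate1968, §1] -/
theorem finitePresentation_of_away (x : 𝓞 L) [IsLocalization.Away x B] : Algebra.FinitePresentation (𝓞 L) B :=
  IsLocalization.Away.finitePresentation x

variable {Z : SchemeOver L}

/-- **The model over an intermediate ring `𝓞 L ⊆ B ⊆ L`, VIEWED over `𝓞 F`** (record: `B = 𝒪_L[1∕N]`, the base of the fine moduli scheme):
restriction of scalars of `𝓜 : IntegralModel B L Z` to an integral model over `𝓞 F` of `Z` regarded over `F` — ★ `restrictScalars` at the pushout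
square `isPushout_of_injective`.  For `Z = X ⊗_F L` the target is `IntegralModel (𝓞 F) F ((thickening F L).obj X)` on the nose.
[cite: SerreTate1968, §1] -/
def restrictScalarsOfIntermediate (hinj : Function.Injective (algebraMap B L)) (𝓜 : IntegralModel B L Z) :
    IntegralModel (𝓞 F) F (SchemeOver.restrictScalars F Z) :=
  haveI := isPushout_of_injective (F := F) hinj
  restrictScalars (A := 𝓞 F) (K := F) 𝓜

/-- `restrictScalarsOfIntermediate` is ★ `restrictScalars` at the square `𝓞 F → F`, `B → L`. [cite: SerreTate1968, §1] -/
theorem restrictScalarsOfIntermediate_eq (hinj : Function.Injective (algebraMap B L)) (𝓜 : IntegralModel B L Z) :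
    haveI := isPushout_of_injective (F := F) hinj
    restrictScalarsOfIntermediate (F := F) hinj 𝓜 = restrictScalars (A := 𝓞 F) (K := F) 𝓜 := rfl

/-- Its structure morphism is `𝓜.total → Spec B → Spec 𝓞 F`. [cite: GortzWedhorn2020, Prop. 4.16 and §(4.8)] -/
theorem restrictScalarsOfIntermediate_total_hom (hinj : Function.Injective (algebraMap B L)) (𝓜 : IntegralModel B L Z) :
    (restrictScalarsOfIntermediate (F := F) hinj 𝓜).total.hom = 𝓜.total.hom ≫ Spec.map (CommRingCat.ofHom (algebraMap (𝓞 F) B)) := rfl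

/-- Its total space has the same underlying scheme. [cite: GortzWedhorn2020, Prop. 4.16 and §(4.8)] -/
theorem restrictScalarsOfIntermediate_total_left (hinj : Function.Injective (algebraMap B L)) (𝓜 : IntegralModel B L Z) :
    (restrictScalarsOfIntermediate (F := F) hinj 𝓜).total.left = 𝓜.total.left := rfl

/-- EQV-SPREAD binder 1: quasi-compact (`Spec B → Spec 𝓞 F` is affine). [cite: GortzWedhorn2020, Prop. 4.16 and §(4.8)] -/
theorem quasiCompact_restrictScalarsOfIntermediate (hinj : Function.Injective (algebraMap B L)) (𝓜 : IntegralModel B L Z)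
    [QuasiCompact 𝓜.total.hom] : QuasiCompact (restrictScalarsOfIntermediate (F := F) hinj 𝓜).total.hom := by
  rw [restrictScalarsOfIntermediate_total_hom]; infer_instance

/-- EQV-SPREAD binder 2: quasi-separated. [cite: GortzWedhorn2020, Prop. 4.16 and §(4.8)] -/
theorem quasiSeparated_restrictScalarsOfIntermediate (hinj : Function.Injective (algebraMap B L)) (𝓜 : IntegralModel B L Z)
    [QuasiSeparated 𝓜.total.hom] : QuasiSeparated (restrictScalarsOfIntermediate (F := F) hinj 𝓜).total.hom := by
  rw [restrictScalarsOfIntermediate_total_hom]; infer_instance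

/-- EQV-SPREAD binder 5: separated. [cite: GortzWedhorn2020, Prop. 4.16 and §(4.8)] -/
theorem isSeparated_restrictScalarsOfIntermediate (hinj : Function.Injective (algebraMap B L)) (𝓜 : IntegralModel B L Z)
    [IsSeparated 𝓜.total.hom] : IsSeparated (restrictScalarsOfIntermediate (F := F) hinj 𝓜).total.hom := by
  rw [restrictScalarsOfIntermediate_total_hom]; infer_instance

/-- EQV-SPREAD binder 4: flat, for `B` flat over `𝓞 L`. [cite: SerreTate1968, §1] -/
theorem flat_restrictScalarsOfIntermediate [IsScalarTower (𝓞 F) (𝓞 L) B] (hinj : Function.Injective (algebraMap B L))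
    (𝓜 : IntegralModel B L Z) [Module.Flat (𝓞 L) B] [Flat 𝓜.total.hom] : Flat (restrictScalarsOfIntermediate (F := F) hinj 𝓜).total.hom := by
  haveI := flat_specMap_of_flat (F := F) (L := L) (B := B)
  rw [restrictScalarsOfIntermediate_total_hom]; infer_instance

/-- EQV-SPREAD binder 3: locally of finite presentation, for `B` finitely presented over `𝓞 L`. [cite: SerreTate1968, §1] -/
theorem locallyOfFinitePresentation_restrictScalarsOfIntermediate [IsScalarTower (𝓞 F) (𝓞 L) B]
    (hinj : Function.Injective (algebraMap B L)) (𝓜 : IntegralModel B L Z)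
    [Algebra.FinitePresentation (𝓞 L) B] [LocallyOfFinitePresentation 𝓜.total.hom] :
    LocallyOfFinitePresentation (restrictScalarsOfIntermediate (F := F) hinj 𝓜).total.hom := by
  haveI := locallyOfFinitePresentation_specMap_of_finitePresentation (F := F) (L := L) (B := B)
  rw [restrictScalarsOfIntermediate_total_hom]; infer_instance

/-- The AWAY case of binder 4: `B = 𝓞 L[1∕x]`. [cite: SerreTate1968, §1] -/
theorem flat_restrictScalarsOfIntermediate_of_away [IsScalarTower (𝓞 F) (𝓞 L) B] (x : 𝓞 L) [IsLocalization.Away x B]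
    (hinj : Function.Injective (algebraMap B L)) (𝓜 : IntegralModel B L Z) [Flat 𝓜.total.hom] : Flat (restrictScalarsOfIntermediate (F := F) hinj 𝓜).total.hom :=
  haveI := flat_of_isLocalization (B := B) (Submonoid.powers x)
  flat_restrictScalarsOfIntermediate hinj 𝓜

/-- The AWAY case of binder 3: `B = 𝓞 L[1∕x]`. [cite: SerreTate1968, §1] -/
theorem locallyOfFinitePresentation_restrictScalarsOfIntermediate_of_away [IsScalarTower (𝓞 F) (𝓞 L) B] (x : 𝓞 L)
    [IsLocalization.Away x B] (hinj : Function.Injective (algebraMap B L)) (𝓜 : IntegralModel B L Z)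
    [LocallyOfFinitePresentation 𝓜.total.hom] :
    LocallyOfFinitePresentation (restrictScalarsOfIntermediate (F := F) hinj 𝓜).total.hom :=
  haveI := finitePresentation_of_away (B := B) x
  locallyOfFinitePresentation_restrictScalarsOfIntermediate hinj 𝓜

/-- The generic isomorphism of the viewed model against `𝓜`'s, under the projections to `𝓜.total` (★ `restrictScalars_genericIso_hom_left_comp`).
[cite: GortzWedhorn2020, Prop. 4.16 and §(4.8)] -/
theorem restrictScalarsOfIntermediate_genericIso_hom_left_comp (hinj : Function.Injective (algebraMap B L)) (𝓜 : IntegralModel B L Z) :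
    (restrictScalarsOfIntermediate (F := F) hinj 𝓜).genericIso.hom.left ≫ 𝓜.genericIso.inv.left ≫
        pullback.fst 𝓜.total.hom (Spec.map (CommRingCat.ofHom (algebraMap B L))) =
      pullback.fst (𝓜.total.hom ≫ Spec.map (CommRingCat.ofHom (algebraMap (𝓞 F) B)))
        (Spec.map (CommRingCat.ofHom (algebraMap (𝓞 F) F))) :=
  haveI := isPushout_of_injective (F := F) hinj
  restrictScalars_genericIso_hom_left_comp (A := 𝓞 F) (K := F) 𝓜

end Intermediate

end Literature.AlgebraicGeometry.Motives.IntegralModel
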